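import Literature.Analysis.FluidPDE.DeRosaScheme
import Literature.Analysis.FluidPDE.OnsagerFlexibilityProofs
import HarnessLib

/-!
# De Rosa's convex-integration scheme: one step of Prop. 4.1 along a construction history,
# Prop. 4.1 run from zero in the regime `γ < β` (named fact), and the iteration (proved)

L. De Rosa, *Infinitely many Leray–Hopf solutions for the fractional Navier–Stokes equations*,
Comm. PDE 44 (2019) 335–365 = arXiv:1801.10235, proves his Thm. 2.1 (prescribed-energy Hölder
solutions of the hypodissipative Navier–Stokes system; the tree's `DeRosa2019_thm21`) in §4.2 by
running the **main iterative proposition** Prop. 4.1 — one step of the Buckmaster–De Lellis–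
Székelyhidi–Vicol scheme for the fractional Navier–Stokes–Reynolds system (NSR), §§5–8 — **from the
zero triple** ("Now we apply Proposition 4.1 iteratively with `(v₀, R₀, p₀) = (0,0,0)`"), which
yields the whole sequence `(v_q, p_q, R̊_q)_q` of smooth solutions of (NSR) with the inductive
estimates (4.7)–(4.10), the increment bounds (4.12) and the clause "`v_{q+1}(·,0)` depends only on
`e(0)` and `v_q(·,0)`". With the vocabulary of `DeRosaScheme.lean` (`DeRosa.IsAdmissibleProfile`,
`DeRosa.IsDeRosaSequence`; parameters and norms from `OnsagerBDSV`) this file fixes the one-step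
statement along a history, vendors Prop. 4.1 run from zero as a named fact (research-level, not
proved here) and proves the iteration of §4.2:

* `DeRosa.IsHistory … e q v p R` — a **construction history up to stage `q`**: `v₀ = 0`, the
  stages `j ≤ q` solve (NSR) (`Torus.IsFracNSReynoldsOn (Icc 0 T) γ ν`) and obey (4.7)–(4.10)
  (`BDSV.InductiveEstimates`), and the increments `v_{j+1} - v_j`, `j < q`, obey (4.12)
  (`BDSV.VelocityIncrementBound`); a De Rosa sequence (`DeRosa.IsDeRosaSequence`) is exactly a
  family of fields all of whose truncations are histories (`isDeRosaSequence_iff_isHistory`).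
* `DeRosa.StepAt M β γ α a b ν T` — **one step of Prop. 4.1 at fixed parameters, along a
  history**: for every stage `q` there is a map `Ψ_q` such that for every normalised profile `e`
  (`BDSV.IsNormalisedProfile`, (4.2)) and every history up to stage `q` there is a triple
  `(v_{q+1}, p_{q+1}, R̊_{q+1})` solving (NSR), obeying (4.7)–(4.10) at stage `q+1` and (4.12),
  with `v_{q+1}(·,0) = Ψ_q (e(0)) (v_q(·,0))`.
* `DeRosa.SchemeAt M β γ α a b ν T` — **Prop. 4.1 run from zero at fixed parameters**: maps
  `V, P, St` on profiles producing De Rosa sequences for admissible profiles, with time-zero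
  slices depending on the profile only through `e(0)`.
* **named fact** `DeRosa.iterativeSchemeLT` — Prop. 4.1 with its printed quantifier prefix,
  restricted to `γ < β`, before `SchemeAt`, i.e. Prop. 4.1 run from zero, the form §4.2 consumes
  (see "Faithfulness"). The one-step form under the same prefix (`∃ M > 0, ∀ β γ b …, StepAt …`,
  Prop. 4.1 along histories) is NOT a separate named fact (D-0026: it is an interior node between
  the three stage facts of `DeRosaThreeStages.lean` and `iterativeSchemeLT` with all reductions
  proved; the restricted one-step fact `DeRosa.inductiveStepLT` and the stage-estimates fact
  `DeRosa.stagesEstimate` that stood in between briefly were merged back into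
  `iterativeSchemeLT`'s proof obligation): it is DERIVED from the three stages of §5 in
  `DeRosaStagesProofs.lean` (`DeRosa.stepAt_of_threeStages`) and feeds `iterativeSchemeLT`
  through `iterativeSchemeLT_of_stepAt` below.
* **proved**: `schemeAt_of_stepAt : StepAt … → SchemeAt …` (the iteration of §4.2: dependent
  choice along histories, `BDSV.exists_seq_of_step`, plus the induction giving equal time-zero
  slices from equal `e(0)`), hence `iterativeSchemeLT_of_stepAt` (the one-step form under the
  prefix implies `iterativeSchemeLT`).

The assembly `iterativeSchemeLT` + `DeRosa.timeRegularity` ⇒ `DeRosa2019_thm21` (the rest of §4.2)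
is `DeRosaSchemeProofs.lean`; the layer below (the three stages of §5 ⇒ the seven stage estimates,
`DeRosa.stageEstimates_of_threeStages` ⇒ `(∃ M …, StepAt …)`, `DeRosa.stepAt_of_threeStages` ⇒
`iterativeSchemeLT`, `DeRosa.iterativeSchemeLT_of_threeStages`) is `DeRosaStages.lean` /
`DeRosaStagesProofs.lean`, and the three stage facts are `DeRosaThreeStages.lean`
(`DeRosa.mollificationStage` is discharged in `DeRosaMollificationProofs.lean`).

## Faithfulness: why histories, why `Ψ`, why only the regime `γ < β`

* *Histories.* Prop. 4.1 is printed as a one-step statement whose hypotheses on the input are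
  (NSR)–(4.4) and (4.7)–(4.10) at stage `q`. Its proof uses more: in the proof of Prop. 5.5,
  estimate (5.18) (p. 14 of the arXiv text: "since `‖v_q‖_γ ≤ 1` for every `γ < β` (as already
  exploited in the proof of Proposition 4.1), by (5.9), Theorem 7.1 and Cauchy–Schwarz …") and in
  the proof of Lemma 5.9 (p. 15, the bound on `d/dt ∫ |v̄_q|²`), the uniform spatial Hölder bound
  of `v_q` that §4.2 derives by summing (4.12) over ALL previous stages of the iteration started
  from zero ("`∑_q ‖v_{q+1} - v_q‖_{β'} ≲ ∑_q λ_q^{β'-β}` … `v_q` is uniformly bounded in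
  `C⁰_t C^{β'}_x` for all `β' < β`"). That bound is not implied by (4.7)–(4.10) at stage `q`
  (which give `[v_q]_{γ'} ≲ (δ_q^{1/2} λ_q)^{γ'} → ∞` only). `StepAt` therefore takes as input
  exactly what the iteration from zero provides and what the printed proof consumes — a
  construction history — and `StepAt` under the printed prefix is Prop. 4.1 in the form in which
  §4.2 applies it. Asking for the history weakens the one-step statement.
* *`Ψ`.* "Furthermore, `v_{q+1}(·,0)` depends only on `e(0)` and `v_q(·,0)`" (Prop. 4.1, last
  sentence; §5.4: "Note that the dependence of `w_{q+1}(·,0)` on the function `e(t)` is only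
  trough the value `e(0)`") says that the construction at stage `q` — with the parameters, the
  mollifier, the cut-offs and the Mikado profiles fixed — determines `v_{q+1}(·,0)` as a function
  of the pair `(e(0), v_q(·,0))`: this is `∃ Ψ_q, ∀ inputs, v_{q+1}(·,0) = Ψ_q (e 0) (v_q(·,0))`,
  with `Ψ_q` quantified after the parameters `M, β, γ, α, a, b, ν, T, q` and before the profile
  and the input triple. Iterated from `v₀ = 0` it yields clause (b) of `SchemeAt`
  (`schemeAt_of_stepAt`), which is what the last sentence of Thm. 2.1 needs.
* *The regime `γ < β`.* Prop. 4.1 prints "`0 < β < 1/3`, `0 < γ < 1/3`" with no relation between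
  the dissipation exponent `γ` and the Hölder exponent `β`. The printed proof, however, covers
  only `γ < β`: it invokes the history bound `‖v_q‖_{γ'} ≤ 1` at an exponent `γ' ≥ γ + α`
  strictly between `γ` and `β` (proof of (5.18), p. 14: Cor. 7.2 needs `[·]_{γ+ε}`, the history
  bound holds only below `β`; likewise the bound on `2ν ∫ |(-Δ)^{γ/2} v̄_q|²` in the proof of
  Lemma 5.9, p. 15), which is void unless `γ < β`; and the last step of the proof of Prop. 5.3
  ((5.12), p. 13: "using (4.11), `τ_q ℓ^{-2γ-2α} ≤ λ_{q+1}^{2γ}/(δ_q^{1/2} λ_q) ≤ 1`") needs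
  `2γb ≤ 1 - β`, implied by (4.11) only for `γ ≤ β`. All uses of Prop. 4.1 in the paper are in
  the regime `γ < β` (Thm. 1.2: "if `γ < β < 1/3`"; §4.3: "if we chose `γ < β < β'`"; Thm. 2.1 as
  read by the tree's `DeRosa2019_thm21`, and `DeRosaSchemeProofs`, run the scheme with `γ < β`).
  The fact is therefore vendored for `0 < γ < β < 1/3` only — the part of Prop. 4.1 that is a
  result of the source; the unrestricted transcriptions (`β, γ` independent) formerly in the tree,
  `DeRosa.inductiveStep` and `DeRosa.iterativeScheme`, had no proof in the source for `γ ≥ β` and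
  were withdrawn (D-0026 review), every consumer using the restricted fact.
* *Viscosity and normalisations* (as in `DeRosaScheme.lean`): "In (NSR) the viscosity `ν` is just
  some small constant (in particular `ν < 1`) depending on some parameters of the inductive
  construction" (§4.1); it is `μ = δ₁^{1/2}` in §4.2 and `ν_n = δ_n^{1+β'}` in §4.3, the constants
  of §§5–7 being uniform in `0 < ν < 1` (Prop. 5.3: "`0 < ν < 1`"; §3 is `ν`-independent), so
  `ν ∈ (0,1)` and `T > 0` are quantified after `a`. The produced triples solve (NSR) classically
  (`Torus.IsFracNSReynoldsOn`); De Rosa's normalisations (4.3) `tr R̊ = 0`, (4.4) `∫ p = 0` are not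
  demanded (dropping conclusions weakens the fact; §4.2 does not use them).

## References

* L. De Rosa, Comm. PDE 44 (2019), 335–365 = arXiv:1801.10235: §4.1 Prop. 4.1 with (4.2),
  (4.5)–(4.12); §4.2 (iteration from zero, the uniform `C^{β'}` bound); §5.2, proof of Prop. 5.5,
  (5.18) (p. 14); proof of Prop. 5.3, (5.12) (p. 13); §5.3, Lemma 5.9 (p. 15); §5.4 (time-zero
  dependence); Thm. 1.2, §4.3 (the regime `γ < β`). [`Derosa2018`]
* T. Buckmaster, C. De Lellis, L. Székelyhidi Jr., V. Vicol, CPAM 72 (2019) = arXiv:1701.08678,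
  Prop. 2.1, §2.2. [`BuckmasterEtAl2018`]
-/

open MeasureTheory Set Filter
open scoped NNReal ENNReal ContDiff

noncomputable section

namespace Literature.Analysis.FluidPDE

namespace DeRosa

/-- The flat three-torus `𝕋³ = (ℝ/ℤ)³`, local notation. -/
local notation "𝕋³" => UnitAddTorus (Fin 3)

/-- Euclidean `ℝ³`, local notation. -/
local notation "ℝ³" => EuclideanSpace ℝ (Fin 3)

/-! ## Construction histories -/

section Histories

/-- **A construction history up to stage `q`** of De Rosa's scheme with parameters
`(M, β, γ, α, a, b)`, viscosity `ν`, time `T` and profile `e` (§4.2: the first `q` steps of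
"apply Proposition 4.1 iteratively with `(v₀, R₀, p₀) = (0,0,0)`"): fields
`(v_j, p_j, R_j)_{j ∈ ℕ}` (only `j ≤ q` matter) with `v₀ = 0`, every stage `j ≤ q` a smooth
solution of the fractional Navier–Stokes–Reynolds system (NSR) with exponent `γ` and viscosity
`ν` on `[0,T] × 𝕋³` obeying the inductive estimates (4.7)–(4.10) at stage `j`, and every
increment `v_{j+1} - v_j`, `j < q`, obeying (4.12). These are the inputs along which Prop. 4.1 is
proved and applied (its proof uses the bound `‖v_q‖_{γ'} ≤ 1`, `γ' < β`, obtained in §4.2 by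
summing (4.12) over the history). [cite: Derosa2018, §4.1 Prop. 4.1, (4.7)–(4.10), (4.12); §4.2] -/
structure IsHistory (M β γ α a b ν T : ℝ) (e : ℝ → ℝ) (q : ℕ) (v : ℕ → ℝ → 𝕋³ → ℝ³)
    (p : ℕ → ℝ → 𝕋³ → ℝ) (R : ℕ → ℝ → 𝕋³ → Fin 3 → ℝ³) : Prop where
  /-- The construction starts from the zero velocity. -/
  velocity_zero : v 0 = fun _ _ => 0
  /-- Every stage `j ≤ q` solves (NSR) classically on `[0,T] × 𝕋³`. -/
  isFracNSReynoldsOn : ∀ j ≤ q, Torus.IsFracNSReynoldsOn (Icc 0 T) γ ν (v j) (p j) (R j)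
  /-- The inductive estimates (4.7)–(4.10) hold at every stage `j ≤ q`. -/
  inductiveEstimates : ∀ j ≤ q, BDSV.InductiveEstimates M β α a b T e j (v j) (R j)
  /-- The increment bound (4.12) holds for every `j < q`. -/
  velocityIncrementBound : ∀ j < q,
    BDSV.VelocityIncrementBound M β a b T j (fun t x => v (j + 1) t x - v j t x)

variable {M β γ α a b ν T : ℝ} {e : ℝ → ℝ} {q : ℕ} {v v' : ℕ → ℝ → 𝕋³ → ℝ³}
  {p p' : ℕ → ℝ → 𝕋³ → ℝ} {R R' : ℕ → ℝ → 𝕋³ → Fin 3 → ℝ³}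

/-- Truncation: a history up to stage `q` is a history up to every earlier stage. [folklore] -/
theorem IsHistory.mono (h : IsHistory M β γ α a b ν T e q v p R) {j : ℕ} (hj : j ≤ q) :
    IsHistory M β γ α a b ν T e j v p R where
  velocity_zero := h.velocity_zero
  isFracNSReynoldsOn i hi := h.isFracNSReynoldsOn i (hi.trans hj)
  inductiveEstimates i hi := h.inductiveEstimates i (hi.trans hj)
  velocityIncrementBound i hi := h.velocityIncrementBound i (lt_of_lt_of_le hi hj)

/-- A history up to stage `q` depends only on the stages `j ≤ q` of the fields. [folklore] -/
theorem IsHistory.congr (h : IsHistory M β γ α a b ν T e q v p R) (hv : ∀ j ≤ q, v' j = v j)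
    (hp : ∀ j ≤ q, p' j = p j) (hR : ∀ j ≤ q, R' j = R j) :
    IsHistory M β γ α a b ν T e q v' p' R' where
  velocity_zero := by
    rw [hv 0 (Nat.zero_le q)]
    exact h.velocity_zero
  isFracNSReynoldsOn j hj := by
    rw [hv j hj, hp j hj, hR j hj]
    exact h.isFracNSReynoldsOn j hj
  inductiveEstimates j hj := by
    rw [hv j hj, hR j hj]
    exact h.inductiveEstimates j hj
  velocityIncrementBound j hj := by
    rw [hv j hj.le, hv (j + 1) (Nat.succ_le_of_lt hj)]
    exact h.velocityIncrementBound j hj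

/-- **The history of length `0`**: for an admissible profile (`DeRosa.IsAdmissibleProfile`:
normalised, and (4.11), i.e. the zero triple obeys (4.7)–(4.10) at stage `0` — "the pair
`(v₀, R₀)` trivially satisfies (4.7)–(4.9), whereas the estimate (4.10) … follows as a
consequence of (4.11)", §4.2), fields starting with the zero triple form a history up to stage
`0` (the zero triple solves (NSR), `Torus.isFracNSReynoldsOn_zero`). [cite: Derosa2018, §4.2] -/
theorem isHistory_zero (he : IsAdmissibleProfile M β α a b T e) (hv : v 0 = fun _ _ => 0)
    (hp : p 0 = fun _ _ => 0) (hR : R 0 = fun _ _ _ => 0) : IsHistory M β γ α a b ν T e 0 v p R where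
  velocity_zero := hv
  isFracNSReynoldsOn j hj := by
    obtain rfl := Nat.le_zero.1 hj
    rw [hv, hp, hR]
    exact Torus.isFracNSReynoldsOn_zero (Icc 0 T) γ ν
  inductiveEstimates j hj := by
    obtain rfl := Nat.le_zero.1 hj
    rw [hv, hR]
    exact he.inductiveEstimates_zero
  velocityIncrementBound j hj := absurd hj (Nat.not_lt_zero j)

/-- Every truncation of a De Rosa sequence is a construction history. [folklore] -/
theorem IsDeRosaSequence.isHistory (h : IsDeRosaSequence M β γ α a b ν T e v p R) (q : ℕ) :
    IsHistory M β γ α a b ν T e q v p R where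
  velocity_zero := h.velocity_zero
  isFracNSReynoldsOn j _ := h.isFracNSReynoldsOn j
  inductiveEstimates j _ := h.inductiveEstimates j
  velocityIncrementBound j _ := h.velocityIncrementBound j

/-- Fields all of whose truncations are construction histories form a De Rosa sequence. [folklore] -/
theorem isDeRosaSequence_of_isHistory (h : ∀ q, IsHistory M β γ α a b ν T e q v p R) :
    IsDeRosaSequence M β γ α a b ν T e v p R where
  velocity_zero := (h 0).velocity_zero
  isFracNSReynoldsOn q := (h q).isFracNSReynoldsOn q le_rfl
  inductiveEstimates q := (h q).inductiveEstimates q le_rfl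
  velocityIncrementBound q := (h (q + 1)).velocityIncrementBound q (Nat.lt_succ_self q)

/-- A De Rosa sequence is the same thing as a family of fields all of whose truncations are
construction histories. [folklore] -/
theorem isDeRosaSequence_iff_isHistory :
    IsDeRosaSequence M β γ α a b ν T e v p R ↔ ∀ q, IsHistory M β γ α a b ν T e q v p R :=
  ⟨fun h q => h.isHistory q, isDeRosaSequence_of_isHistory⟩

end Histories

/-! ## One step along a history, and the scheme, at fixed parameters -/

section Fixed

/-- **One step of Prop. 4.1 at fixed parameters, along a construction history** (De Rosa 2019,
Prop. 4.1 as proved in §5 and applied in §4.2): for every stage `q` there is a map `Ψ = Ψ_q`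
(the time-zero trace of the construction) such that for every normalised profile `e` on `[0,T]`
((4.2), `BDSV.IsNormalisedProfile`) and every construction history `(v_j, p_j, R_j)_{j ≤ q}`
(`DeRosa.IsHistory`: from zero, (NSR), (4.7)–(4.10) at all stages `≤ q`, (4.12) for all earlier
increments) there is a smooth solution `(v_{q+1}, p_{q+1}, R̊_{q+1})` of (NSR) with exponent `γ`
and viscosity `ν` on `[0,T] × 𝕋³` satisfying (4.7)–(4.10) with `q` replaced by `q+1`, the
increment bound (4.12) `‖v_{q+1} - v_q‖₀ + λ_{q+1}^{-1}‖v_{q+1} - v_q‖₁ ≤ M δ_{q+1}^{1/2}`, and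
`v_{q+1}(·,0) = Ψ (e(0)) (v_q(·,0))` ("`v_{q+1}(·,0)` depends only on `e(0)` and `v_q(·,0)`").
[cite: Derosa2018, §4.1 Prop. 4.1; §4.2] -/
def StepAt (M β γ α a b ν T : ℝ) : Prop :=
  ∀ q : ℕ, ∃ Ψ : ℝ → (𝕋³ → ℝ³) → (𝕋³ → ℝ³),
    ∀ e : ℝ → ℝ, BDSV.IsNormalisedProfile T e →
      ∀ (v : ℕ → ℝ → 𝕋³ → ℝ³) (p : ℕ → ℝ → 𝕋³ → ℝ) (R : ℕ → ℝ → 𝕋³ → Fin 3 → ℝ³),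
        IsHistory M β γ α a b ν T e q v p R →
          ∃ (v' : ℝ → 𝕋³ → ℝ³) (p' : ℝ → 𝕋³ → ℝ) (R' : ℝ → 𝕋³ → Fin 3 → ℝ³),
            Torus.IsFracNSReynoldsOn (Icc 0 T) γ ν v' p' R' ∧
            BDSV.InductiveEstimates M β α a b T e (q + 1) v' R' ∧
            BDSV.VelocityIncrementBound M β a b T q (fun t x => v' t x - v q t x) ∧
            v' 0 = Ψ (e 0) (v q 0)

/-- **Prop. 4.1 run from zero, at fixed parameters** (De Rosa 2019, §4.2, "we apply
Proposition 4.1 iteratively with `(v₀, R₀, p₀) = (0,0,0)`"): there are maps `V, P, St` on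
profiles such that (a) for every admissible profile `e` (`DeRosa.IsAdmissibleProfile`: normalised,
and (4.11)) the fields `(V e, P e, St e)` form a De Rosa sequence (`DeRosa.IsDeRosaSequence`: from
zero, (NSR) with exponent `γ` and viscosity `ν`, (4.7)–(4.10) and (4.12) at every stage), and
(b) admissible profiles with the same value at `0` yield the same time-zero velocity slices at
every stage ("`v_{q+1}(·,0)` depends only on `e(0)` and `v_q(·,0)`", iterated from `v₀ = 0`).
[cite: Derosa2018, §4.1 Prop. 4.1 and §4.2] -/
def SchemeAt (M β γ α a b ν T : ℝ) : Prop :=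
  ∃ (V : (ℝ → ℝ) → ℕ → ℝ → 𝕋³ → ℝ³) (P : (ℝ → ℝ) → ℕ → ℝ → 𝕋³ → ℝ)
    (St : (ℝ → ℝ) → ℕ → ℝ → 𝕋³ → Fin 3 → ℝ³),
    (∀ e : ℝ → ℝ, IsAdmissibleProfile M β α a b T e →
      IsDeRosaSequence M β γ α a b ν T e (V e) (P e) (St e)) ∧
    ∀ e e' : ℝ → ℝ, IsAdmissibleProfile M β α a b T e →
      IsAdmissibleProfile M β α a b T e' → e 0 = e' 0 →
      ∀ q, V e q 0 = V e' q 0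

variable {M β γ α a b ν T : ℝ}

/-- **The iteration along histories** (De Rosa 2019, §4.2, "we apply Proposition 4.1 iteratively
with `(v₀, R₀, p₀) = (0,0,0)`", for ONE admissible profile): if one step along every history is
available with time-zero traces `Ψ_q`, there are fields `(v_q, p_q, R_q)_q` all of whose
truncations are histories and whose time-zero velocity slices obey
`v_{q+1}(·,0) = Ψ_q (e(0)) (v_q(·,0))`. Proof: dependent choice (`BDSV.exists_seq_of_step`) on
whole sequences of triples, extending a history up to stage `q` by the triple the step provides,
then passing to the diagonal. [cite: Derosa2018, §4.2] -/
theorem exists_histories_of_step {Ψ : ℕ → ℝ → (𝕋³ → ℝ³) → (𝕋³ → ℝ³)}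
    (hΨ : ∀ q, ∀ e : ℝ → ℝ, BDSV.IsNormalisedProfile T e →
      ∀ (v : ℕ → ℝ → 𝕋³ → ℝ³) (p : ℕ → ℝ → 𝕋³ → ℝ) (R : ℕ → ℝ → 𝕋³ → Fin 3 → ℝ³),
        IsHistory M β γ α a b ν T e q v p R →
          ∃ (v' : ℝ → 𝕋³ → ℝ³) (p' : ℝ → 𝕋³ → ℝ) (R' : ℝ → 𝕋³ → Fin 3 → ℝ³),
            Torus.IsFracNSReynoldsOn (Icc 0 T) γ ν v' p' R' ∧
            BDSV.InductiveEstimates M β α a b T e (q + 1) v' R' ∧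
            BDSV.VelocityIncrementBound M β a b T q (fun t x => v' t x - v q t x) ∧
            v' 0 = Ψ q (e 0) (v q 0))
    {e : ℝ → ℝ} (he : IsAdmissibleProfile M β α a b T e) :
    ∃ (v : ℕ → ℝ → 𝕋³ → ℝ³) (p : ℕ → ℝ → 𝕋³ → ℝ) (R : ℕ → ℝ → 𝕋³ → Fin 3 → ℝ³),
      (∀ q, IsHistory M β γ α a b ν T e q v p R) ∧ ∀ q, v (q + 1) 0 = Ψ q (e 0) (v q 0) := by
  classical
  -- dependent choice on sequences of triples `s : ℕ → (velocity × pressure × stress)`: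
  -- stage-`q` property = "history up to `q` with the time-zero relations for `j < q`",
  -- relation = "the new sequence extends the old one up to `q`"
  obtain ⟨Z, -, hP, hQ⟩ := BDSV.exists_seq_of_step
    (X := ℕ → (ℝ → 𝕋³ → ℝ³) × (ℝ → 𝕋³ → ℝ) × (ℝ → 𝕋³ → Fin 3 → ℝ³))
    (P := fun q s => IsHistory M β γ α a b ν T e q (fun j => (s j).1) (fun j => (s j).2.1)
        (fun j => (s j).2.2) ∧ ∀ j < q, (s (j + 1)).1 0 = Ψ j (e 0) ((s j).1 0))
    (Q := fun q s s' => ∀ j ≤ q, s' j = s j)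
    (x₀ := fun _ => ((fun _ _ => 0), (fun _ _ => 0), (fun _ _ _ => 0)))
    ⟨isHistory_zero he rfl rfl rfl, fun j hj => absurd hj (Nat.not_lt_zero j)⟩
    (by
      rintro q s ⟨hH, hΨs⟩
      obtain ⟨v', p', R', hN, hI, hV, h0⟩ :=
        hΨ q e he.isNormalisedProfile (fun j => (s j).1) (fun j => (s j).2.1) (fun j => (s j).2.2) hH
      have hn : ¬ (q + 1 ≤ q) := Nat.not_succ_le_self q
      refine ⟨fun j => if j ≤ q then s j else (v', p', R'), ⟨⟨?_, ?_, ?_, ?_⟩, ?_⟩,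
        fun j hj => if_pos hj⟩
      · simp only [Nat.zero_le, ↓reduceIte]
        exact hH.velocity_zero
      · intro j hj
        rcases Nat.lt_or_eq_of_le hj with hj' | rfl
        · have hjq : j ≤ q := Nat.lt_succ_iff.1 hj'
          simp only [hjq, ↓reduceIte]
          exact hH.isFracNSReynoldsOn j hjq
        · simp only [hn, ↓reduceIte]
          exact hN
      · intro j hj
        rcases Nat.lt_or_eq_of_le hj with hj' | rfl
        · have hjq : j ≤ q := Nat.lt_succ_iff.1 hj'
          simp only [hjq, ↓reduceIte]
          exact hH.inductiveEstimates j hjq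
        · simp only [hn, ↓reduceIte]
          exact hI
      · intro j hj
        rcases Nat.lt_or_eq_of_le (Nat.lt_succ_iff.1 hj) with hj' | rfl
        · simp only [hj'.le, Nat.succ_le_of_lt hj', ↓reduceIte]
          exact hH.velocityIncrementBound j hj'
        · simp only [le_refl, hn, ↓reduceIte]
          exact hV
      · intro j hj
        rcases Nat.lt_or_eq_of_le (Nat.lt_succ_iff.1 hj) with hj' | rfl
        · simp only [hj'.le, Nat.succ_le_of_lt hj', ↓reduceIte]
          exact hΨs j hj'
        · simp only [le_refl, hn, ↓reduceIte]
          exact h0)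
  -- the diagonal sequence and its stability
  have hstab : ∀ q, ∀ j ≤ q, Z q j = Z j j := by
    intro q
    induction q with
    | zero =>
        intro j hj
        rw [Nat.le_zero.1 hj]
    | succ q ih =>
        intro j hj
        rcases Nat.lt_or_eq_of_le hj with hj' | rfl
        · have hjq : j ≤ q := Nat.lt_succ_iff.1 hj'
          rw [hQ q j hjq, ih j hjq]
        · rfl
  refine ⟨fun j => (Z j j).1, fun j => (Z j j).2.1, fun j => (Z j j).2.2, fun q => ?_, fun q => ?_⟩
  · exact (hP q).1.congr (fun j hj => by simp only [hstab q j hj])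
      (fun j hj => by simp only [hstab q j hj]) (fun j hj => by simp only [hstab q j hj])
  · have h1 := (hP (q + 1)).2 q (Nat.lt_succ_self q)
    rw [hstab (q + 1) q (Nat.le_succ q)] at h1
    exact h1

/-- **One step along every history gives the scheme** (De Rosa 2019, §4.2, for fixed
parameters): `StepAt M β γ α a b ν T → SchemeAt M β γ α a b ν T`. The maps `V, P, St` are
obtained profile by profile from `exists_histories_of_step` (junk for non-admissible profiles);
clause (b) — equal `e(0)` give equal time-zero slices at every stage — follows by induction on
the stage from `v₀ = 0` and `v_{q+1}(·,0) = Ψ_q (e(0)) (v_q(·,0))`, the maps `Ψ_q` being the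
same for all profiles. [cite: Derosa2018, §4.2] -/
theorem schemeAt_of_stepAt (h : StepAt M β γ α a b ν T) : SchemeAt M β γ α a b ν T := by
  classical
  choose Ψ hΨ using h
  have key : ∀ e : ℝ → ℝ, ∃ (v : ℕ → ℝ → 𝕋³ → ℝ³) (p : ℕ → ℝ → 𝕋³ → ℝ)
      (R : ℕ → ℝ → 𝕋³ → Fin 3 → ℝ³), IsAdmissibleProfile M β α a b T e →
        (∀ q, IsHistory M β γ α a b ν T e q v p R) ∧ ∀ q, v (q + 1) 0 = Ψ q (e 0) (v q 0) := by
    intro e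
    by_cases he : IsAdmissibleProfile M β α a b T e
    · obtain ⟨v, p, R, hH, h0⟩ := exists_histories_of_step hΨ he
      exact ⟨v, p, R, fun _ => ⟨hH, h0⟩⟩
    · exact ⟨fun _ _ _ => 0, fun _ _ _ => 0, fun _ _ _ _ => 0, fun h => absurd h he⟩
  choose V P St hVPS using key
  refine ⟨V, P, St, fun e he => isDeRosaSequence_of_isHistory (hVPS e he).1, ?_⟩
  intro e e' he he' h0 q
  induction q with
  | zero => rw [((hVPS e he).1 0).velocity_zero, ((hVPS e' he').1 0).velocity_zero]
  | succ q ih => rw [(hVPS e he).2 q, (hVPS e' he').2 q, h0, ih]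

end Fixed

/-! ## The named fact and the iteration -/

section Facts

/-- **De Rosa 2019, Prop. 4.1 (main iterative proposition) run from zero, in the regime `γ < β`
covered by its printed proof — named fact.** As printed (§4.1, Prop. 4.1): "There exists a
universal constant `M` with the following property. Let `0 < β < 1/3`, `0 < γ < 1/3` and (4.11)
`1 < b < min{(1-β)/(2β), 4/3}`. Then there exists an `α₀` depending only on `β` and `b`, such that
for any `0 < α < α₀` there exists an `a₀` depending on `β`, `b`, `α` and `M`, such that for any
`a ≥ a₀` the following holds: given a strictly positive function `e : [0,T] → ℝ⁺` satisfying
(4.2), and a triple `(v_q, p_q, R̊_q)` solving (NSR)–(4.4) and satisfying the estimates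
(4.7)–(4.10), then there exists a solution `(v_{q+1}, p_{q+1}, R̊_{q+1})` to (NSR)–(4.4) satisfying
(4.7)–(4.10) with `q` replaced by `q+1`. Moreover, we have (4.12)
`‖v_{q+1} - v_q‖₀ + λ_{q+1}^{-1}‖v_{q+1} - v_q‖₁ ≤ M δ_{q+1}^{1/2}`. Furthermore, `v_{q+1}(·,0)`
depends only on `e(0)` and `v_q(·,0)`." And §4.2: "Now we apply Proposition 4.1 iteratively with
`(v₀, R₀, p₀) = (0,0,0)`. Indeed the pair `(v₀, R₀)` trivially satisfies (4.7)–(4.9), whereas the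
estimate (4.10) and (4.2) follows as a consequence of (4.11)". Transcription: the printed
quantifier prefix (`∃ M > 0`; `∀ β ∈ (0,1/3)`; `∀ γ ∈ (0,β)`; `∀ b` with `1 < b < (1-β)/(2β)`,
`b < 4/3`; `∃ α₀ > 0`; `∀ α ∈ (0,α₀)`; `∃ a₀ > 1`; `∀ a ≥ a₀`) with the exponents in the regime
`0 < γ < β < 1/3` — the regime covered by the printed proof of Prop. 4.1 (the proof of (5.18),
p. 14, uses the history bound `‖v_q‖_{γ'} ≤ 1`, available only for `γ' < β`, at an exponent
`γ' ∈ (γ, β)`; so does the proof of Lemma 5.9, p. 15; the proof of (5.12), p. 13, uses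
`2γb ≤ 1 - β`, which (4.11) gives only for `γ ≤ β`) and used by Thm. 1.2, Thm. 2.1 (as read by the
tree's `DeRosa2019_thm21`) and §4.3, see the module docstring — then every viscosity `ν ∈ (0,1)`
("the viscosity `ν` is just some small constant (in particular `ν < 1`)", §4.1; the constants of
§§5–7 are uniform in `0 < ν < 1`), every `T > 0`, and `DeRosa.SchemeAt`: maps `V, P, St`
assigning to each profile a sequence of fields such that (a) for every ADMISSIBLE profile `e`
(`DeRosa.IsAdmissibleProfile M β α a b T e`: normalised (4.2), and (4.11), i.e. the zero triple
obeys (4.7)–(4.10) at stage `0`) the sequence `(V e, P e, St e)` is a De Rosa sequence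
(`DeRosa.IsDeRosaSequence`: starts from zero, solves (NSR) with exponent `γ` and viscosity `ν` at
every stage, obeys (4.7)–(4.10) and (4.12) at every stage); (b) for admissible profiles `e, e'`
with `e 0 = e' 0`, `V e q 0 = V e' q 0` for every `q` ("`v_{q+1}(·,0)` depends only on `e(0)` and
`v_q(·,0)`" iterated from `v₀ = 0`; what the last sentence of Thm. 2.1 needs). This is the form in
which §4.2 consumes Prop. 4.1 (`DeRosaSchemeProofs.lean` deduces `DeRosa2019_thm21` from it and
`DeRosa.timeRegularity`); it follows from the one-step form of Prop. 4.1 along histories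
(`DeRosa.StepAt` under the same prefix) by the iteration (`iterativeSchemeLT_of_stepAt`), and that
form from the three stages of §5 (`DeRosa.stepAt_of_threeStages`,
`DeRosa.iterativeSchemeLT_of_threeStages` in `DeRosaStagesProofs.lean`). Not proved here (§§5–8
of the paper). [cite: Derosa2018, §4.1 Prop. 4.1 and §4.2 (iteration from zero)] -/
def iterativeSchemeLT : Prop :=
  ∃ M : ℝ, 0 < M ∧
    ∀ β : ℝ, 0 < β → β < 1 / 3 → ∀ γ : ℝ, 0 < γ → γ < β →
      ∀ b : ℝ, 1 < b → b < (1 - β) / (2 * β) → b < 4 / 3 →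
        ∃ α₀ : ℝ, 0 < α₀ ∧ ∀ α : ℝ, 0 < α → α < α₀ →
          ∃ a₀ : ℝ, 1 < a₀ ∧ ∀ a : ℝ, a₀ ≤ a →
            ∀ ν : ℝ, 0 < ν → ν < 1 → ∀ T : ℝ, 0 < T → SchemeAt M β γ α a b ν T

/-- **Prop. 4.1 along histories implies Prop. 4.1 run from zero** (De Rosa 2019, §4.2, "we apply
Proposition 4.1 iteratively with `(v₀, R₀, p₀) = (0,0,0)`"): the one-step statement `StepAt` under
the quantifier prefix of Prop. 4.1 (regime `γ < β`; the conclusion of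
`DeRosa.stepAt_of_threeStages`, `DeRosaStagesProofs.lean`) implies `iterativeSchemeLT`, by
`schemeAt_of_stepAt` under the common prefix. [cite: Derosa2018, §4.2] -/
theorem iterativeSchemeLT_of_stepAt
    (h : ∃ M : ℝ, 0 < M ∧
      ∀ β : ℝ, 0 < β → β < 1 / 3 → ∀ γ : ℝ, 0 < γ → γ < β →
        ∀ b : ℝ, 1 < b → b < (1 - β) / (2 * β) → b < 4 / 3 →
          ∃ α₀ : ℝ, 0 < α₀ ∧ ∀ α : ℝ, 0 < α → α < α₀ →
            ∃ a₀ : ℝ, 1 < a₀ ∧ ∀ a : ℝ, a₀ ≤ a →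
              ∀ ν : ℝ, 0 < ν → ν < 1 → ∀ T : ℝ, 0 < T → StepAt M β γ α a b ν T) :
    iterativeSchemeLT := by
  obtain ⟨M, hM, h⟩ := h
  refine ⟨M, hM, fun β hβ hβ3 γ hγ hγβ b hb hbβ hb43 => ?_⟩
  obtain ⟨α₀, hα₀, h⟩ := h β hβ hβ3 γ hγ hγβ b hb hbβ hb43
  refine ⟨α₀, hα₀, fun α hα hαα₀ => ?_⟩
  obtain ⟨a₀, ha₀, h⟩ := h α hα hαα₀
  exact ⟨a₀, ha₀, fun a ha ν hν hν1 T hT => schemeAt_of_stepAt (h a ha ν hν hν1 T hT)⟩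

end Facts

end DeRosa

end Literature.Analysis.FluidPDE
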